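import Mathlib
import HarnessLib
import Literature.Probability.MarkovChains.MultipleTryIndependenceSampler
import Literature.Probability.MarkovChains.PeskunOrdering

/-!
# At equal proposal cost the multiple-try correction (MTM-IS) Peskun-dominates the Barker–Tjelmeland
# pool-selection correction (i-SIR): smaller asymptotic variance for every observable, larger
# spectral gap

HONEST FRAMING: exact (Metropolis-corrected) sampling algorithms for lattice gauge theory;
figures of merit are autocorrelation/cost numbers at stated couplings and volumes; no
continuum-physics claim.

Venture `LatticeQCDFlow` (cell pub-lqcd), topic `Scoring`; row 33 (`lit-codes`,
literature-prover seat GEN-41).  NEW WORK of the cell — an elementary consequence of two Literature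
files, stated because it bears on the lever `imh.n_proposals_per_step` of `LEVERS.md` (whose EXACT
invariant names "the Barker/Tjelmeland multi-proposal weights"): nothing here is cited as a fact and
no definition is introduced.  The objects are the Literature ones:
`Literature.Probability.MarkovChains.mtmisKernel q p n` — the multiple-try Metropolized independence
sampler MTM-IS with `n + 1` i.i.d. proposals from the model `q`, select `∝ w`, accept with
`min{1, W/(W − w(y) + w(x))}` (Liu 2001 §5.5.1; Yang–Liu 2021, `MultipleTryIndependenceSampler.lean`)
— and `isirKernel q p (n + 1)` — the i-SIR / "use all proposals" rule with the SAME `n + 1` fresh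
proposals, next state drawn from the pool `{x, y_0, …, y_n}` with probability `∝ w` (Tjelmeland
2004; for one proposal, Barker's acceptance).  Both leave `p` exactly invariant
(`mtmisKernel_isStationary`, `isirKernel_isStationary`) and both cost `n + 1` proposals / weight
evaluations per update.

## Content (target `p > 0`, `Σ p = 1`; model `q > 0`, `Σ q = 1`; finite state space)

* `isirMove_le_mtmisMove` — OFF-DIAGONAL DOMINATION: for every `x, y`,
  `A^{iSIR}_move(x,y) = H_{n+1}(w(x) + w(y))·p(y) ≤ min{H_{n+1}(w(x)), H_{n+1}(w(y))}·p(y) =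
  A^{MTM}_move(x,y)` — the two Literature closed forms (`isirMove_eq`, `mtmisMove_eq`) and
  monotonicity of Yang–Liu's `H` (`mtmH_antitone`): the pool denominator `w(x) + w(y) + R` exceeds
  both `w(x) + R` and `w(y) + R`.
* `isirKernel_le_mtmisKernel_offDiag` — hence `A^{iSIR}(x,y) ≤ A^{MTM}(x,y)` for `x ≠ y`.
* `isirKernel_isIrreducible`, `mtmisKernel_isIrreducible` — both kernels have all entries positive.
* **`asympVar_mtmis_le_isir`** — PESKUN: `v(f, p, A^{MTM}) ≤ v(f, p, A^{iSIR})` for EVERY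
  observable `f` (Literature `PeskunOrdering.asympVar_le_of_offDiag_le`, Peskun 1973 Thm 2.1.1, with
  `asympVar` = Kemeny–Snell's `lim N·var` of the ergodic average, `PeskunOrdering.tendsto_varSum_div`).
* **`spectralGapR_isir_le_mtmis`** — and the right spectral gap is ordered the same way,
  `Gap_R(A^{iSIR}) ≤ Gap_R(A^{MTM})` (`PeskunOrdering.spectralGapR_mono_of_offDiag_le`).
* Reading, with the Literature rate theorems: per update both multi-proposal rules are exact; the
  multiple-try rule is never worse than pool selection in asymptotic variance or spectral gap at the
  same number of proposals; and by Yang–Liu's Theorem 3.2 (`mtmis_rate_ge_imh_pow`) even MTM-IS(k)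
  converges no faster than `k` plain IMH updates — so at equal proposal count neither multi-proposal
  correction beats repeated single-proposal IMH in convergence RATE (what they buy is parallel
  evaluation of the `k` weights, not statistical efficiency).

Printed context (named, not used): Martino's review of multiple-try schemes reports the ordering
I-MTM ≻ "I-MTM2"/ensemble (pool-selection) rules only as a NUMERICAL observation — "for `N = 1`,
the results confirm the Peskun's ordering … Observing the results, the Peskun's ordering appears
valid also for the multiple try case, `N > 1`" (Martino2018, §7.1) — and for general (dependent)
proposal mechanisms no selection rule dominates all others (Tjelmeland 2004, as quoted by
Pozza–Zanella 2025 §2); the theorem below is the independent-proposal case, where the domination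
does hold pointwise.  The complementary UPPER bound — any `π`-reversible `K`-proposal kernel is
Peskun-dominated by `K` times a single-proposal Metropolis–Hastings kernel, so `Gap ≤ K · Gap(MH)`
(Pozza–Zanella 2025 Thm 1 / Cor 1) — is the Literature file
`Probability/MarkovChains/MultiproposalPeskunBound.lean`.

NOT CLAIMED: strict inequalities; any comparison of i-SIR with IMHᵏ in asymptotic variance (Peskun's
order does not compare a kernel with a `k`-fold power); dependent / correlated proposal mechanisms;
wall-clock or parallel cost models; anything about a specific flow or any number of ours.
-/

namespace Summit.Ventures.LatticeQCDFlow.Scoring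

open Finset Literature.Probability.MarkovChains

variable {X : Type*} [Fintype X] [DecidableEq X] {p q : X → ℝ}

/-- **Off-diagonal domination of i-SIR by MTM-IS at the same number `n + 1` of fresh proposals**:
`A^{iSIR}_move(x,y) = H_{n+1}(w_x + w_y) p_y ≤ min{H_{n+1}(w_x), H_{n+1}(w_y)} p_y = A^{MTM}_move(x,y)`. -/
theorem isirMove_le_mtmisMove (hp : ∀ x, 0 < p x) (hq : ∀ x, 0 < q x) (n : ℕ) (x y : X) :
    isirMove q p (n + 1) x y ≤ mtmisMove q p n x y := by
  rw [isirMove_eq hq, mtmisMove_eq hp hq]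
  have hwx : 0 < p x / q x := div_pos (hp x) (hq x)
  have hwy : 0 < p y / q y := div_pos (hp y) (hq y)
  refine mul_le_mul_of_nonneg_right (le_min ?_ ?_) (hp y).le
  · exact mtmH_antitone hp hq n hwx (by linarith)
  · exact mtmH_antitone hp hq n hwy (by linarith)

/-- Hence the full kernels are ordered off the diagonal: `A^{iSIR}(x,y) ≤ A^{MTM}(x,y)`, `x ≠ y`. -/
theorem isirKernel_le_mtmisKernel_offDiag (hp : ∀ x, 0 < p x) (hq : ∀ x, 0 < q x) (n : ℕ)
    {x y : X} (hxy : x ≠ y) : isirKernel q p (n + 1) x y ≤ mtmisKernel q p n x y := by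
  unfold isirKernel mtmisKernel
  rw [if_neg (Ne.symm hxy), if_neg (Ne.symm hxy), add_zero, add_zero]
  exact isirMove_le_mtmisMove hp hq n x y

/-- Every entry of the i-SIR kernel (with at least one fresh proposal) is positive. -/
theorem isirKernel_pos (hp : ∀ x, 0 < p x) (hq : ∀ x, 0 < q x) (n : ℕ) (x y : X) :
    0 < isirKernel q p (n + 1) x y := by
  haveI : Nonempty X := ⟨x⟩
  have hmove : 0 < isirMove q p (n + 1) x y := by
    rw [isirMove_eq hq]
    exact mul_pos (mtmH_pos hp hq n (add_pos (div_pos (hp x) (hq x)) (div_pos (hp y) (hq y))))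
      (hp y)
  unfold isirKernel
  by_cases hyx : y = x
  · rw [if_pos hyx]
    linarith [isirStay_nonneg hp hq (n + 1) x]
  · rw [if_neg hyx, add_zero]
    exact hmove

/-- Every entry of the MTM-IS kernel is positive. -/
theorem mtmisKernel_pos (hp : ∀ x, 0 < p x) (hq : ∀ x, 0 < q x) (n : ℕ) (x y : X) :
    0 < mtmisKernel q p n x y := by
  have h1 := isirKernel_pos hp hq n x y
  by_cases hxy : x = y
  · subst hxy
    haveI : Nonempty X := ⟨x⟩
    have hmove : 0 < mtmisMove q p n x x := by
      rw [mtmisMove_eq hp hq, min_self]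
      exact mul_pos (mtmH_pos hp hq n (div_pos (hp x) (hq x))) (hp x)
    unfold mtmisKernel
    rw [if_pos rfl]
    linarith [mtmisStay_nonneg hp hq n x]
  · exact h1.trans_le (isirKernel_le_mtmisKernel_offDiag hp hq n hxy)

/-- The i-SIR kernel is irreducible (one step suffices). -/
theorem isirKernel_isIrreducible (hp : ∀ x, 0 < p x) (hq : ∀ x, 0 < q x) (n : ℕ) :
    IsIrreducible (isirKernel q p (n + 1) : Matrix X X ℝ) := fun x y =>
  ⟨1, by rw [pow_one]; exact isirKernel_pos hp hq n x y⟩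

/-- The MTM-IS kernel is irreducible (one step suffices). -/
theorem mtmisKernel_isIrreducible (hp : ∀ x, 0 < p x) (hq : ∀ x, 0 < q x) (n : ℕ) :
    IsIrreducible (mtmisKernel q p n : Matrix X X ℝ) := fun x y =>
  ⟨1, by rw [pow_one]; exact mtmisKernel_pos hp hq n x y⟩

/-- **PESKUN DOMINATION: at the same number `n + 1` of fresh proposals per update, the multiple-try
rule has asymptotic variance no larger than the pool-selection (i-SIR / Barker–Tjelmeland) rule,
for EVERY observable `f`**: `v(f, p, A^{MTM}) ≤ v(f, p, A^{iSIR})` (Peskun 1973 Thm 2.1.1 as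
`PeskunOrdering.asympVar_le_of_offDiag_le`, both kernels being `p`-reversible). -/
theorem asympVar_mtmis_le_isir (hp : ∀ x, 0 < p x) (hp1 : ∑ x, p x = 1) (hq : ∀ x, 0 < q x)
    (hq1 : ∑ x, q x = 1) (n : ℕ) (f : X → ℝ) :
    asympVar f p (mtmisKernel q p n : Matrix X X ℝ) ≤
      asympVar f p (isirKernel q p (n + 1) : Matrix X X ℝ) :=
  asympVar_le_of_offDiag_le hp hp1 (mtmisKernel_isRowStochastic hp hq hq1 n)
    (isirKernel_isRowStochastic hp hq hq1 (n + 1)) (mtmisKernel_detailedBalance hp hq n)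
    (isirKernel_detailedBalance hq (n + 1)) (isirKernel_isIrreducible hp hq n)
    (fun _ _ hxy => isirKernel_le_mtmisKernel_offDiag hp hq n hxy) f

/-- **The right spectral gaps are ordered the same way**: `Gap_R(A^{iSIR}) ≤ Gap_R(A^{MTM})`
(`PeskunOrdering.spectralGapR_mono_of_offDiag_le`). -/
theorem spectralGapR_isir_le_mtmis (hp : ∀ x, 0 < p x) (hq : ∀ x, 0 < q x) (hq1 : ∑ x, q x = 1)
    (n : ℕ) :
    spectralGapR p (isirKernel q p (n + 1) : Matrix X X ℝ) ≤
      spectralGapR p (mtmisKernel q p n : Matrix X X ℝ) :=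
  spectralGapR_mono_of_offDiag_le (fun x => (hp x).le)
    (fun x y => (isirKernel_isRowStochastic hp hq hq1 (n + 1)).1 x y)
    (fun _ _ hxy => isirKernel_le_mtmisKernel_offDiag hp hq n hxy)

end Summit.Ventures.LatticeQCDFlow.Scoring
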